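import Mathlib.Analysis.Complex.ExponentialBounds
import Mathlib.Analysis.Real.Pi.Bounds
import Mathlib.Analysis.SpecialFunctions.Pow.Real
import Mathlib.Analysis.SpecialFunctions.Log.Basic
import Mathlib.Data.Nat.Factorial.Basic
import HarnessLib

/-!
# Javanpeykar 2014, §4.2–4.6: the arithmetic of the height bound
# (`r ≤ 2 e m e_𝔭`, `Σ_{p ≤ d} ⌊log d/log p⌋ log p ≤ d log d`, `6378031`, `6378033`, `13·10⁶`)

Topic `NumberTheory/DiophantineGeometry`; companion of `BelyiDegreeFaltingsHeight.lean` (the named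
fact `javanpeykar2014_stableFaltingsHeight_le`: `h_F(E) ≤ 13·10⁶ deg_B(E)⁵`, Thm. 1.1.1 row 1 of
A. Javanpeykar, *Polynomial bounds for Arakelov invariants of Belyi curves*, Algebra & Number Theory
**8** (2014), arXiv:1403.6404), of `BelyiDegreeFaltingsHeightProofs.lean` (Lemma 3.2.2) and of
`BelyiCoverMerklAtlasConstants.lean` (§3.4–3.5). The non-archimedean half and the assembly of the
printed proof (Prop. 4.2.4 → Thm. 4.5.1 → Thm. 4.5.2 → §4.6) contain the following elementary
claims, all CHECKED here as theorems (the Arakelov-theoretic objects — models `𝒴′ → 𝒴 → ℙ¹_{O_K}`,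
intersection numbers, `h(b)`, `‖Wr‖_Ar` — are not available, so each display is rendered as the
real/natural-number inequality it asserts):

* `lemma423` — Lemma 4.2.3: `r ≤ e - 1 + e·m·e_𝔭`, `m, e_𝔭 ≥ 1` ⇒ `r ≤ 2 e m e_𝔭`;
* `sum_floor_log_div_log_mul_log_le`, `prop424_wild_bound` — Prop. 4.2.4:
  **`Σ_{p ≤ d prime} ⌊log d/log p⌋ log p ≤ d log d`** (each term `≤ log d`, at most `d` terms);
* `log_mul_mul_sub_le` (`(0+1+∞, Q)_fin = log(pq(q-p)) [K:ℚ] ≤ 3 log q [K:ℚ]`),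
  `two_mul_sq_mul_log_le` (`2d² log d ≤ 2d³`), **`thm451_assembly`** (`3 h d² + 2 d³ + (6378027 d⁵/g
  + 2) ≤ 3 h d² + 6378031 d⁵/g` for `1 ≤ g ≤ d`) — Thm. 4.5.1;
* `coprime_two_mul_sub_one`, `a_mem_Ioc` (`a_n = n/(2n-1) ∈ (1/2, 2/3]`, `n ≥ 2`),
  `log_max_le_log_two_mul` (`h_naive(a_n) = log(2n - 1) ≤ log(2n)`),
  **`three_mul_log_mul_sq_le`** (`3 log(2d²) d² ≤ 2 d⁵/g` for `2 ≤ d`, `1 ≤ g ≤ d`; false for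
  `d = 1`, harmless as `deg π ≥ 3`, `three_le_finrank_of_isBelyiFunction`), `thm452_constant`
  (`2 + 6378031 = 6378033`) — Thm. 4.5.2;
* **`final_constant`** — §4.6: `½ g(g+1)·6378033 d⁵/g + 6378028 g d⁵ ≤ 13·10⁶ g d⁵` (`g ≥ 1`);
  for `g = 1`: `12756061 d⁵ ≤ 13·10⁶ d⁵`, the constant of `javanpeykar2014_stableFaltingsHeight_le`.

No definition, no named fact.

## References

* A. Javanpeykar, *Polynomial bounds for Arakelov invariants of Belyi curves* (appendix by
  P. Bruin), Algebra & Number Theory 8 (2014), no. 1, 89–140, doi:10.2140/ant.2014.8.89,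
  arXiv:1403.6404: Lemma 4.2.3, Prop. 4.2.4, Thm. 4.5.1, Thm. 4.5.2, §4.6. [Javanpeykar2014]
-/

noncomputable section

open Real

namespace Literature.NumberTheory.DiophantineGeometry

namespace Javanpeykar2014

/-! ### §4.2: Lemma 4.2.3 and the prime sum of Prop. 4.2.4 -/

/-- **Lemma 4.2.3 (arithmetic step)**: from `r ≤ e - 1 + e · (m e_𝔭)` (Prop. 4.1.3 with
`ord_{D_i}(p^m) = m e_𝔭`) and `m ≥ 1` (as `p ≤ deg π`), `e_𝔭 ≥ 1`: **`r ≤ 2 e m e_𝔭`**.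
[cite: Javanpeykar2014, Lemma 4.2.3] -/
theorem lemma423 {r e m e' : ℕ} (h : r ≤ e - 1 + e * (m * e')) (hm : 1 ≤ m) (he' : 1 ≤ e') :
    r ≤ 2 * e * m * e' := by
  have h1 : e ≤ e * (m * e') := by
    calc e = e * (1 * 1) := by ring
      _ ≤ e * (m * e') := Nat.mul_le_mul_left e (Nat.mul_le_mul hm he')
  have h2 : e - 1 + e * (m * e') ≤ 2 * e * m * e' := by
    have : 2 * e * m * e' = e * (m * e') + e * (m * e') := by ring
    omega
  exact h.trans h2

/-- **The prime sum of Prop. 4.2.4**: `Σ_{p ≤ d prime} ⌊log d/log p⌋ log p ≤ d log d` ("where we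
used that `𝒳_p ∩ D₂ ≠ ∅` implies that `p ≤ deg π`": each term is `≤ log d` and there are at most
`d` of them). [cite: Javanpeykar2014, Prop. 4.2.4 (proof)] -/
theorem sum_floor_log_div_log_mul_log_le (d : ℕ) :
    ∑ p ∈ (Finset.range (d + 1)).filter Nat.Prime,
        (⌊Real.log d / Real.log p⌋ : ℝ) * Real.log p ≤ d * Real.log d := by
  have hterm : ∀ p ∈ (Finset.range (d + 1)).filter Nat.Prime,
      (⌊Real.log d / Real.log p⌋ : ℝ) * Real.log p ≤ Real.log d := by
    intro p hp
    have hp2 : (2 : ℝ) ≤ p := by exact_mod_cast (Finset.mem_filter.mp hp).2.two_le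
    have hlogp : 0 < Real.log p := Real.log_pos (by linarith)
    calc (⌊Real.log d / Real.log p⌋ : ℝ) * Real.log p ≤ Real.log d / Real.log p * Real.log p :=
          mul_le_mul_of_nonneg_right (Int.floor_le _) hlogp.le
      _ = Real.log d := div_mul_cancel₀ _ hlogp.ne'
  have hcard : (((Finset.range (d + 1)).filter Nat.Prime).card : ℝ) ≤ d := by
    have h1 : (Finset.range (d + 1)).filter Nat.Prime ⊆ Finset.Ico 2 (d + 1) := by
      intro p hp
      rw [Finset.mem_filter, Finset.mem_range] at hp
      rw [Finset.mem_Ico]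
      exact ⟨hp.2.two_le, hp.1⟩
    have h2 := Finset.card_le_card h1
    rw [Nat.card_Ico] at h2
    have : (((Finset.range (d + 1)).filter Nat.Prime).card : ℝ) ≤ ((d + 1 - 2 : ℕ) : ℝ) := by
      exact_mod_cast h2
    refine this.trans ?_
    rcases Nat.lt_or_ge d 1 with hd | hd
    · have : d = 0 := by omega
      subst this; norm_num
    · rw [Nat.cast_sub (by omega)]; push_cast; linarith
  rcases Nat.eq_zero_or_pos d with rfl | hd
  · simp
  have hlogd : 0 ≤ Real.log d := Real.log_nonneg (by exact_mod_cast hd)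
  calc ∑ p ∈ (Finset.range (d + 1)).filter Nat.Prime, (⌊Real.log d / Real.log p⌋ : ℝ) * Real.log p
      ≤ ∑ p ∈ (Finset.range (d + 1)).filter Nat.Prime, Real.log d := Finset.sum_le_sum hterm
    _ = ((Finset.range (d + 1)).filter Nat.Prime).card * Real.log d := by
        rw [Finset.sum_const, nsmul_eq_mul]
    _ ≤ d * Real.log d := mul_le_mul_of_nonneg_right hcard hlogd

/-- Hence the bound of Prop. 4.2.4: `2 d [K:ℚ] Σ_{p ≤ d} ⌊log d/log p⌋ log p ≤ 2 d² log d [K:ℚ]`.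
[cite: Javanpeykar2014, Prop. 4.2.4] -/
theorem prop424_wild_bound (d : ℕ) {D : ℝ} (hD : 0 ≤ D) :
    2 * (d : ℝ) * D * ∑ p ∈ (Finset.range (d + 1)).filter Nat.Prime,
        (⌊Real.log d / Real.log p⌋ : ℝ) * Real.log p ≤ 2 * (d : ℝ) ^ 2 * Real.log d * D := by
  have h := sum_floor_log_div_log_mul_log_le d
  have hd : (0 : ℝ) ≤ d := Nat.cast_nonneg d
  calc 2 * (d : ℝ) * D * ∑ p ∈ (Finset.range (d + 1)).filter Nat.Prime,
        (⌊Real.log d / Real.log p⌋ : ℝ) * Real.log p ≤ 2 * (d : ℝ) * D * (d * Real.log d) :=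
        mul_le_mul_of_nonneg_left h (by positivity)
    _ = 2 * (d : ℝ) ^ 2 * Real.log d * D := by ring

/-! ### Thm. 4.5.1: `(0 + 1 + ∞, Q)_fin ≤ 3 h_naive(a)` and the final assembly -/

/-- For `a = p/q` with `0 < p < q`: **`log (p q (q - p)) ≤ 3 log q`** (the finite intersection
number `(0 + 1 + ∞, Q)_fin = [K:ℚ] log(pq(q-p)) ≤ 3 log(q) [K:ℚ] = 3 h_naive(a) [K:ℚ]`).
[cite: Javanpeykar2014, Thm. 4.5.1 (proof)] -/
theorem log_mul_mul_sub_le {p q : ℝ} (hp : 0 < p) (hpq : p < q) :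
    Real.log (p * q * (q - p)) ≤ 3 * Real.log q := by
  have hq : 0 < q := hp.trans hpq
  rw [Real.log_mul (mul_pos hp hq).ne' (by linarith), Real.log_mul hp.ne' hq.ne']
  have h1 : Real.log p ≤ Real.log q := Real.log_le_log hp hpq.le
  have h2 : Real.log (q - p) ≤ Real.log q := Real.log_le_log (by linarith) (by linarith)
  linarith

/-- `2 d² log d ≤ 2 d³` (the step `2 (deg π)² log(deg π) ≤ 2 (deg π)³`). [cite: Javanpeykar2014,
Thm. 4.5.1 (proof)] -/
theorem two_mul_sq_mul_log_le {d : ℝ} (hd : 1 ≤ d) : 2 * d ^ 2 * Real.log d ≤ 2 * d ^ 3 := by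
  have := Real.log_le_sub_one_of_pos (by linarith : 0 < d)
  nlinarith [sq_nonneg d]

/-- **The assembly of Thm. 4.5.1**: from `(P′, K_𝒴′)_fin/[K:ℚ] ≤ 3 h d² + 2 d³` (Prop. 4.2.4 with
`2 d² log d ≤ 2 d³`) and `Σ_σ(-log‖dπ_K‖_σ)/[K:ℚ] ≤ 6378027 d⁵/g + 2` (Thm. 3.4.5 + Lemma 4.4.1)
to **`h(b) ≤ 3 h d² + 6378031 d⁵/g`**, for `1 ≤ g ≤ d`. [cite: Javanpeykar2014, Thm. 4.5.1] -/
theorem thm451_assembly {h d g x : ℝ} (hg : 1 ≤ g) (hgd : g ≤ d)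
    (hx : x ≤ (3 * h * d ^ 2 + 2 * d ^ 3) + (6378027 * d ^ 5 / g + 2)) :
    x ≤ 3 * h * d ^ 2 + 6378031 * d ^ 5 / g := by
  have hd : 1 ≤ d := hg.trans hgd
  have hg0 : 0 < g := by linarith
  have h45 : d ^ 4 ≤ d ^ 5 / g := by
    rw [le_div_iff₀ hg0]; nlinarith [pow_pos (by linarith : (0:ℝ) < d) 4]
  have h34 : 2 * d ^ 3 + 2 ≤ 4 * d ^ 4 := by nlinarith [pow_pos (by linarith : (0:ℝ) < d) 3]
  have : 6378031 * d ^ 5 / g = 6378027 * d ^ 5 / g + 4 * (d ^ 5 / g) := by ring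
  rw [this]
  linarith

/-! ### Thm. 4.5.2: the points `a_n = n/(2n-1)` and the final numerics -/

/-- `n` and `2n - 1` are coprime (`n ≥ 1`). [folklore] -/
theorem coprime_two_mul_sub_one {n : ℕ} (hn : 1 ≤ n) : Nat.Coprime n (2 * n - 1) := by
  rw [← Nat.isCoprime_iff_coprime]
  refine ⟨2, -1, ?_⟩
  rw [Nat.cast_sub (by omega)]
  push_cast
  ring

/-- For `n ≥ 2`: **`a_n = n/(2n-1) ∈ (1/2, 2/3]`** ("Note that `1/2 ≤ a_n ≤ 2/3`").
[cite: Javanpeykar2014, Thm. 4.5.2 (proof)] -/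
theorem a_mem_Ioc {n : ℕ} (hn : 2 ≤ n) : (n : ℝ) / (2 * n - 1) ∈ Set.Ioc (1 / 2 : ℝ) (2 / 3) := by
  have hn' : (2 : ℝ) ≤ n := by exact_mod_cast hn
  have hpos : (0 : ℝ) < 2 * n - 1 := by linarith
  constructor
  · rw [lt_div_iff₀ hpos]; linarith
  · rw [div_le_iff₀ hpos]; linarith

/-- **`h_naive(a_n) = log(2n - 1) ≤ log(2n)`** for `a_n = n/(2n-1)`, `n ≥ 1` (numerator and
denominator are coprime, `coprime_two_mul_sub_one`, and `max(n, 2n-1) = 2n-1`).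
[cite: Javanpeykar2014, Thm. 4.5.2 (proof)] -/
theorem log_max_le_log_two_mul {n : ℕ} (hn : 1 ≤ n) :
    Real.log (max (n : ℝ) (2 * n - 1)) ≤ Real.log (2 * n) := by
  have hn' : (1 : ℝ) ≤ n := by exact_mod_cast hn
  rw [max_eq_right (by linarith)]
  exact Real.log_le_log (by linarith) (by linarith)

/-- **`3 log(2 d²) d² ≤ 2 d⁵/g`** for integers `2 ≤ d`, reals `1 ≤ g ≤ d` (the last step of the
proof of Thm. 4.5.2, with the pigeonhole index `i ≤ d²`, `h_naive(a_i) ≤ log(2d²)`; false for `d = 1`,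
but `deg π ≥ 3` for a Belyi cover of positive genus, `three_le_finrank_of_isBelyiFunction`).
[cite: Javanpeykar2014, Thm. 4.5.2 (proof)] -/
theorem three_mul_log_mul_sq_le {d : ℕ} (hd : 2 ≤ d) {g : ℝ} (hg : 1 ≤ g) (hgd : g ≤ d) :
    3 * Real.log (2 * (d : ℝ) ^ 2) * (d : ℝ) ^ 2 ≤ 2 * (d : ℝ) ^ 5 / g := by
  have hd' : (2 : ℝ) ≤ d := by exact_mod_cast hd
  have hg0 : 0 < g := by linarith
  have hlog2 : Real.log 2 ≤ 0.6932 := Real.log_two_lt_d9.le.trans (by norm_num)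
  have hlogd : Real.log d ≤ d - 1 := Real.log_le_sub_one_of_pos (by linarith)
  have hsplit : Real.log (2 * (d : ℝ) ^ 2) = Real.log 2 + 2 * Real.log d := by
    rw [Real.log_mul (by norm_num) (by positivity), Real.log_pow]; push_cast; ring
  rw [le_div_iff₀ hg0, hsplit]
  -- `3 (log 2 + 2 log d) d² g ≤ 3 (log 2 + 2 log d) d³ ≤ 2 d⁵`
  have hlogpos : 0 ≤ Real.log 2 + 2 * Real.log d := by
    have := Real.log_nonneg (by linarith : (1:ℝ) ≤ d)
    have := Real.log_nonneg (by norm_num : (1:ℝ) ≤ 2)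
    linarith
  have h1 : 3 * (Real.log 2 + 2 * Real.log d) * (d : ℝ) ^ 2 * g ≤
      3 * (Real.log 2 + 2 * Real.log d) * (d : ℝ) ^ 3 := by
    have : (d : ℝ) ^ 2 * g ≤ (d : ℝ) ^ 3 := by nlinarith [sq_nonneg (d : ℝ)]
    nlinarith
  refine h1.trans ?_
  rcases eq_or_lt_of_le hd with h2 | h3
  · -- `d = 2`: `3 (3 log 2) · 8 ≤ 64`
    have hd2 : (d : ℝ) = 2 := by exact_mod_cast h2.symm
    rw [hd2]
    nlinarith
  · have hd3 : (3 : ℝ) ≤ d := by exact_mod_cast h3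
    -- `3 (0.7 + 2(d-1)) ≤ 2 d²` for `d ≥ 3`
    have hkey : 3 * (Real.log 2 + 2 * Real.log d) ≤ 2 * (d : ℝ) ^ 2 := by nlinarith
    have hd3pos : 0 ≤ (d : ℝ) ^ 3 := by positivity
    nlinarith

/-- The constant of Thm. 4.5.2: `2 + 6378031 = 6378033`, i.e.
`2 d⁵/g + 6378031 d⁵/g = 6378033 d⁵/g`. [cite: Javanpeykar2014, Thm. 4.5.2] -/
theorem thm452_constant (d g : ℝ) : 2 * d ^ 5 / g + 6378031 * d ^ 5 / g = 6378033 * d ^ 5 / g := by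
  ring

/-! ### §4.6, proof of Thm. 1.1.1 (row 1): `½ g(g+1) h(b) + log‖Wr‖ ≤ 13·10⁶ g deg_B(X)⁵` -/

/-- **The final constant** (proof of Thm. 1.1.1 in §4.6): with `h(b) ≤ 6378033 d⁵/g` (Thm. 4.5.2)
and `log ‖Wr‖_Ar(b) ≤ 6378028 g d⁵` (Prop. 3.5.1), Thm. 2.4.1 gives
`h_Fal(X) ≤ ½ g(g+1) · 6378033 d⁵/g + 6378028 g d⁵ ≤ 13·10⁶ g d⁵` (`g ≥ 1`, `d ≥ 0`). For `g = 1`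
this is `12756061 d⁵ ≤ 13·10⁶ d⁵`. [cite: Javanpeykar2014, §4.6 (proof of Thm. 1.1.1)] -/
theorem final_constant {g d : ℝ} (hg : 1 ≤ g) (hd : 0 ≤ d) :
    1 / 2 * g * (g + 1) * (6378033 * d ^ 5 / g) + 6378028 * g * d ^ 5 ≤
      13 * 10 ^ 6 * g * d ^ 5 := by
  have hg0 : g ≠ 0 := by linarith
  have hd5 : 0 ≤ d ^ 5 := by positivity
  have : 1 / 2 * g * (g + 1) * (6378033 * d ^ 5 / g) = 6378033 / 2 * (g + 1) * d ^ 5 := by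
    field_simp
  rw [this]
  nlinarith



/-! ### Thm. 4.5.2: a fibre over some `aᵢ`, `i ≤ d²`, contains a non-Weierstrass point (appended) -/

/-- **The pigeonhole of Thm. 4.5.2.** If `W ⊂ Y` (the Weierstrass points) has at most `g³ - g`
elements, `1 ≤ g ≤ d`, and over each of `d²` distinct points `a ∈ A` the map `f` (`= π`) has a fibre with
(at least) `d` points, then some point of some of these fibres is not in `W` ("Since the number of
Weierstrass points on `Y` is at most `g³ - g`, there exists an integer `1 ≤ i ≤ (deg π)²` such that
the fibre `π⁻¹(aᵢ)` contains a non-Weierstrass point"). [cite: Javanpeykar2014, Thm. 4.5.2 (proof)] -/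
theorem exists_mem_fiber_not_mem {Y X : Type*} [DecidableEq Y] (f : Y → X) (W : Finset Y)
    (A : Finset X) {g d : ℕ} (hg : 1 ≤ g) (hgd : g ≤ d) (hW : W.card ≤ g ^ 3 - g)
    (hA : A.card = d ^ 2) (hfib : ∀ a ∈ A, ∃ S : Finset Y, S.card = d ∧ ∀ y ∈ S, f y = a) :
    ∃ a ∈ A, ∃ y, f y = a ∧ y ∉ W := by
  classical
  choose! S hS using hfib
  -- the union of the chosen fibres
  set U : Finset Y := A.biUnion S with hU
  have hdisj : (A : Set X).PairwiseDisjoint S := by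
    intro a ha b hb hab
    rw [Function.onFun, Finset.disjoint_left]
    intro y hya hyb
    exact hab (((hS a ha).2 y hya).symm.trans ((hS b hb).2 y hyb))
  have hcardU : U.card = d ^ 3 := by
    rw [hU, Finset.card_biUnion hdisj, Finset.sum_congr rfl fun a ha ↦ (hS a ha).1,
      Finset.sum_const, hA, smul_eq_mul]
    ring
  have hlt : W.card < U.card := by
    rw [hcardU]
    have h1 : g ^ 3 - g < g ^ 3 := Nat.sub_lt (by positivity) hg
    have h2 : g ^ 3 ≤ d ^ 3 := Nat.pow_le_pow_left hgd 3
    omega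
  obtain ⟨y, hyU, hyW⟩ := Finset.exists_mem_notMem_of_card_lt_card hlt
  rw [hU, Finset.mem_biUnion] at hyU
  obtain ⟨a, ha, hya⟩ := hyU
  exact ⟨a, ha, y, (hS a ha).2 y hya, hyW⟩


/-! ### Cor. 1.5.1 and Remark 1.5.2: modular curves, Galois Belyi curves, finite-index subgroups
(appended) -/

/-- **The constant of Cor. 1.5.1.** If `deg_B(X) ≤ 128 (g+1)` (Zograf's bound for modular curves;
Galois Belyi curves even have `deg_B ≤ 84(g-1) ≤ 128(g+1)`), then the largest of the four bounds of
Thm. 1.1.1, `5·10⁸ g² deg_B(X)⁵`, is at most `2·10¹⁹ g²(g+1)⁵` (`5·10⁸ · 128⁵ ≈ 1.72·10¹⁹`).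
[cite: Javanpeykar2014, Cor. 1.5.1] -/
theorem cor151_constant {g B : ℝ} (hg : 0 ≤ g) (hB0 : 0 ≤ B) (hB : B ≤ 128 * (g + 1)) :
    5 * 10 ^ 8 * g ^ 2 * B ^ 5 ≤ 2 * 10 ^ 19 * g ^ 2 * (g + 1) ^ 5 := by
  have h5 : B ^ 5 ≤ (128 * (g + 1)) ^ 5 := pow_le_pow_left₀ hB0 hB 5
  have hg2 : 0 ≤ g ^ 2 := sq_nonneg g
  calc 5 * 10 ^ 8 * g ^ 2 * B ^ 5 ≤ 5 * 10 ^ 8 * g ^ 2 * (128 * (g + 1)) ^ 5 := by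
        gcongr
    _ = 5 * 10 ^ 8 * 128 ^ 5 * (g ^ 2 * (g + 1) ^ 5) := by ring
    _ ≤ 2 * 10 ^ 19 * (g ^ 2 * (g + 1) ^ 5) := by
        apply mul_le_mul_of_nonneg_right (by norm_num) (by positivity)
    _ = 2 * 10 ^ 19 * g ^ 2 * (g + 1) ^ 5 := by ring

/-- The four rows of Thm. 1.1.1 under `deg_B ≤ 128(g+1)`, `g ≥ 1`: each of
`13·10⁶ g B⁵`, `3·10⁷ (g-1) B⁵`, `5·10⁸ g² B⁵`, `2·10⁸ g B⁵` (and the `|δ|` lower constant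
`10⁸ g² B⁵`) is `≤ 2·10¹⁹ g²(g+1)⁵`, whence
`max(h_Fal(X), e(X), Δ(X), |δ_Fal(X)|) ≤ 2·10¹⁹ g²(g+1)⁵`. [cite: Javanpeykar2014, Cor. 1.5.1] -/
theorem cor151_rows {g B : ℝ} (hg : 1 ≤ g) (hB0 : 0 ≤ B) (hB : B ≤ 128 * (g + 1)) :
    13 * 10 ^ 6 * g * B ^ 5 ≤ 2 * 10 ^ 19 * g ^ 2 * (g + 1) ^ 5 ∧
      3 * 10 ^ 7 * (g - 1) * B ^ 5 ≤ 2 * 10 ^ 19 * g ^ 2 * (g + 1) ^ 5 ∧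
      5 * 10 ^ 8 * g ^ 2 * B ^ 5 ≤ 2 * 10 ^ 19 * g ^ 2 * (g + 1) ^ 5 ∧
      2 * 10 ^ 8 * g * B ^ 5 ≤ 2 * 10 ^ 19 * g ^ 2 * (g + 1) ^ 5 := by
  have hmain := cor151_constant (by linarith) hB0 hB
  have hB5 : 0 ≤ B ^ 5 := by positivity
  have hgg : g ≤ g ^ 2 := by nlinarith
  have h1 : 13 * 10 ^ 6 * g * B ^ 5 ≤ 5 * 10 ^ 8 * g ^ 2 * B ^ 5 := by nlinarith
  have h2 : 3 * 10 ^ 7 * (g - 1) * B ^ 5 ≤ 5 * 10 ^ 8 * g ^ 2 * B ^ 5 := by nlinarith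
  have h4 : 2 * 10 ^ 8 * g * B ^ 5 ≤ 5 * 10 ^ 8 * g ^ 2 * B ^ 5 := by nlinarith
  exact ⟨h1.trans hmain, h2.trans hmain, hmain, h4.trans hmain⟩

/-- **Remark 1.5.2.** For the curve of a finite-index subgroup `Γ ⊂ SL₂(ℤ)` of index `d`:
`deg_B(Y) ≤ d` and `g ≤ deg_B(Y)` (Lemma 3.2.2), so the largest bound `5·10⁸ g² deg_B(Y)⁵` is
`≤ 5·10⁸ d⁷ ≤ 10⁹ d⁷`. [cite: Javanpeykar2014, Remark 1.5.2] -/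
theorem rem152_constant {g B d : ℝ} (hg : 0 ≤ g) (hgB : g ≤ B) (hBd : B ≤ d) :
    5 * 10 ^ 8 * g ^ 2 * B ^ 5 ≤ 10 ^ 9 * d ^ 7 := by
  have hB : 0 ≤ B := hg.trans hgB
  have hgd : g ≤ d := hgB.trans hBd
  have h1 : g ^ 2 ≤ d ^ 2 := pow_le_pow_left₀ hg hgd 2
  have h2 : B ^ 5 ≤ d ^ 5 := pow_le_pow_left₀ hB hBd 5
  have hd7 : 0 ≤ d ^ 7 := by
    have : 0 ≤ d := hB.trans hBd
    positivity
  calc 5 * 10 ^ 8 * g ^ 2 * B ^ 5 ≤ 5 * 10 ^ 8 * d ^ 2 * d ^ 5 := by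
        gcongr
    _ = 5 * 10 ^ 8 * d ^ 7 := by ring
    _ ≤ 10 ^ 9 * d ^ 7 := by nlinarith

end Javanpeykar2014

end Literature.NumberTheory.DiophantineGeometry

end
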